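import Summits.Ventures.CertifiedManyBodySolver.Downfold.EmeryBandJet
import Summits.Ventures.CertifiedManyBodySolver.Downfold.EmeryBoxesLa214OneBandImage
import Summits.Ventures.CertifiedManyBodySolver.Downfold.EmeryFermiEnergyExistsAll
import Summits.Ventures.CertifiedManyBodySolver.Downfold.EmeryBoxesLa214DopingLevers
import HarnessLib

/-!
# THE WHOLE-BAND `t″` OF THE WORKED EXAMPLE IS POSITIVE FOR EVERY MEMBER: the sign of the jet `t″` of the σ band is
# decided by ONE polynomial `jetSignPoly = gradX·taylor2 − dgradX·∂_εF`, written as a sum of manifestly positive groups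
# on box #18, so `t″_J > 0` at the nodal Fermi point of every member (INFL-3to1-B §B.100 (f); kernel `EmeryBandJet`)

Venture CertifiedManyBodySolver, cell `pub/hubbard-downfold` (stage S1), seat hubbard-downfold-mod-4 (technique B, g44);
namespace `Summit.Ventures.CertifiedManyBodySolver.Downfold.Emery`. Everything PROVED (0 sorry, no certificate: a grouped
polynomial identity (`ring`) + sign arithmetic on the box (`nlinarith`) + the landed one-band image windows for
`∂_εF > 0` at the node).

OBJECT. `EmeryBandJet.jetTpp_pos_iff`: at a diagonal point with `∂_εF > 0` and positive slope `jetP`, the jet's one-band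
`t″_J = −E_xx/32` is positive iff `dgradX < jetP·taylor2`, i.e. iff **`jetSignPoly := gradX·taylor2 − dgradX·∂_εF > 0`**
(multiply by `∂_εF`). §1 `jetSignPoly_eq_grouped` (ring): with `A = t_pd²`,
`jetSignPoly = 256x³(t_pp² − c²)² + 64x²·[A(3t_pp² + 4t_ppc + c²) − c(t_pp² − c²)(4ε + 3Δ)]
 + 16x·[2A² + 2A(3t_ppε + Δc + 2Δt_pp) + c²(6ε² + 8Δε + 3Δ²) − Δt_pp²(2ε + Δ)] + 4c(3ε³ + 6Δε² + 4Δ²ε + Δ³) + 4ΔA(ε + Δ)`;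
§2 `jetSignPoly_pos_la214Box`: on box #18 (`Δ ∈ [1.7, 4.0]`, `t_pd ∈ [1.29, 1.52]`, `t_pp ∈ [0.46, 0.66]`, `c ∈ [0.12, 0.15]`)
every bracket is positive for `0 ≤ ε ≤ 5/2` and every `x ≥ 0` (`3A > c(4ε + 3Δ)`, `4A > t_pp(2ε + Δ)`), so
`jetSignPoly > 0` — DECOUPLED in `(ε, x)`: no Fermi-energy / node coupling is needed; §3 `jetTpp_pos_la214Box`: hence
`t″_J > 0` at every diagonal point `x₀ ≥ 0`, `ε ∈ [0, 5/2]` with `∂_εF > 0`; §4 AT THE NODAL FERMI POINT (`x₀ = xNode(ε_F)`,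
`ε_F = fermiEnergyOf(ν)`, `ν = 1/2` and `7/16`; `∂_εF > 0` from the landed positive scale window `scaleT ∈ [0.3222, 0.5823]`
resp. `[0.3353, 0.6313]` and `fsT > 0`; `0 ≤ ε_F ≤ 487/200` from `fermiEnergyOf_nonneg` / `la214Box_fermiEnergyOf_le_ceiling`):
**`la214Box_jetTpp_pos_x0` / `_x0125` — for EVERY member of `emeryBoxLa214v123` the whole-band (object-M-type) `t″` of
the nodal jet is POSITIVE** (the cuprate sign of [PavariniEtAl2001]; float +0.07…+0.15 over the box, MLWF object M of
record +0.090·t).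

WHAT THIS IS NOT: statements about La₂CuO₄ — SCREENING-GRADE typed box; `U = 0` one-body kinematics; «MLWF object M = nodal
jet» is a float identification; no box edit.
-/

noncomputable section

namespace Summit.Ventures.CertifiedManyBodySolver.Downfold.Emery

open Real Set

/-! ## §1 The sign polynomial and its grouped form -/

/-- The sign polynomial of the jet `t″` at a diagonal point: `jetSignPoly = gradX·taylor2 − dgradX·∂_εF`
(all at `(x, x, ε)`). [folklore] -/
def jetSignPoly (Δ tpd tpp c x ε : ℝ) : ℝ :=
  gradX Δ tpd tpp c x ε * taylor2 Δ c x x ε - dgradX Δ tpd tpp c x ε * dcharCubic Δ tpd tpp c x x ε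

/-- THE GROUPED FORM: `jetSignPoly = 256x³(t_pp² − c²)² + 64x²·B₂ + 16x·B₁ + C₀` with
`B₂ = A(3t_pp² + 4t_ppc + c²) − c(t_pp² − c²)(4ε + 3Δ)`, `B₁ = 2A² + 2A(3t_ppε + Δc + 2Δt_pp) + c²(6ε² + 8Δε + 3Δ²)
− Δt_pp²(2ε + Δ)`, `C₀ = 4c(3ε³ + 6Δε² + 4Δ²ε + Δ³) + 4ΔA(ε + Δ)`, `A = t_pd²`. [folklore] -/
theorem jetSignPoly_eq_grouped (Δ tpd tpp c x ε : ℝ) :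
    jetSignPoly Δ tpd tpp c x ε =
      256 * x ^ 3 * (tpp ^ 2 - c ^ 2) ^ 2
      + 64 * x ^ 2 * (tpd ^ 2 * (3 * tpp ^ 2 + 4 * tpp * c + c ^ 2) - c * (tpp ^ 2 - c ^ 2) * (4 * ε + 3 * Δ))
      + 16 * x * (2 * (tpd ^ 2) ^ 2 + 2 * tpd ^ 2 * (3 * tpp * ε + Δ * c + 2 * Δ * tpp)
          + c ^ 2 * (6 * ε ^ 2 + 8 * Δ * ε + 3 * Δ ^ 2) - Δ * tpp ^ 2 * (2 * ε + Δ))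
      + (4 * c * (3 * ε ^ 3 + 6 * Δ * ε ^ 2 + 4 * Δ ^ 2 * ε + Δ ^ 3) + 4 * Δ * tpd ^ 2 * (ε + Δ)) := by
  unfold jetSignPoly gradX taylor2 dgradX dcharCubic fsD fsN dcA dfsD dfsN
  ring

/-! ## §2 Positivity on box #18, decoupled in `(ε, x)` -/

/-- The `x²` bracket is positive on box #18 for `ε ≤ 5/2` (`3A ≥ 4.99 > c(4ε + 3Δ) ≤ 3.3`). [folklore] -/
theorem jetSign_bracket2_pos {Δ tpd tpp c ε : ℝ} (hΔ : Δ ∈ Icc ((17 : ℝ) / 10) (4 : ℝ))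
    (ha : tpd ∈ Icc ((129 : ℝ) / 100) ((38 : ℝ) / 25)) (hb : tpp ∈ Icc ((23 : ℝ) / 50) ((33 : ℝ) / 50))
    (hc : c ∈ Icc ((3 : ℝ) / 25) ((3 : ℝ) / 20)) (hε : ε ∈ Icc (0 : ℝ) ((5 : ℝ) / 2)) :
    0 < tpd ^ 2 * (3 * tpp ^ 2 + 4 * tpp * c + c ^ 2) - c * (tpp ^ 2 - c ^ 2) * (4 * ε + 3 * Δ) := by
  obtain ⟨hD1, hD2⟩ := hΔ; obtain ⟨ha1, ha2⟩ := ha; obtain ⟨hb1, hb2⟩ := hb; obtain ⟨hc1, hc2⟩ := hc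
  obtain ⟨he1, he2⟩ := hε
  have hA : (16641 : ℝ) / 10000 ≤ tpd ^ 2 := by nlinarith
  have h1 : c * (4 * ε + 3 * Δ) ≤ (33 : ℝ) / 10 := by nlinarith
  have h2 : 0 ≤ tpp ^ 2 - c ^ 2 := by nlinarith
  have h3 : c * (tpp ^ 2 - c ^ 2) * (4 * ε + 3 * Δ) ≤ (33 : ℝ) / 10 * tpp ^ 2 := by
    have hc2 : 0 ≤ c ^ 2 := by positivity
    nlinarith [mul_le_mul_of_nonneg_left h1 h2]
  have hq : 0 ≤ 3 * tpp ^ 2 + 4 * tpp * c + c ^ 2 := by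
    have : 0 ≤ tpp := by linarith
    have : 0 ≤ c := by linarith
    positivity
  have h4 : (16641 : ℝ) / 10000 * (3 * tpp ^ 2) ≤ tpd ^ 2 * (3 * tpp ^ 2 + 4 * tpp * c + c ^ 2) := by
    have hbc : 0 ≤ 4 * tpp * c + c ^ 2 := by
      have : 0 ≤ tpp := by linarith
      have : 0 ≤ c := by linarith
      positivity
    nlinarith [mul_le_mul_of_nonneg_right hA hq]
  have h5 : 0 < tpp ^ 2 := by
    have : 0 < tpp := by linarith
    positivity
  nlinarith

/-- The `x` bracket is positive on box #18 for `ε ≤ 5/2` (`4A ≥ 6.65 > t_pp(2ε + Δ) ≤ 5.94`). [folklore] -/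
theorem jetSign_bracket1_pos {Δ tpd tpp c ε : ℝ} (hΔ : Δ ∈ Icc ((17 : ℝ) / 10) (4 : ℝ))
    (ha : tpd ∈ Icc ((129 : ℝ) / 100) ((38 : ℝ) / 25)) (hb : tpp ∈ Icc ((23 : ℝ) / 50) ((33 : ℝ) / 50))
    (hc : c ∈ Icc ((3 : ℝ) / 25) ((3 : ℝ) / 20)) (hε : ε ∈ Icc (0 : ℝ) ((5 : ℝ) / 2)) :
    0 < 2 * (tpd ^ 2) ^ 2 + 2 * tpd ^ 2 * (3 * tpp * ε + Δ * c + 2 * Δ * tpp)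
          + c ^ 2 * (6 * ε ^ 2 + 8 * Δ * ε + 3 * Δ ^ 2) - Δ * tpp ^ 2 * (2 * ε + Δ) := by
  obtain ⟨hD1, hD2⟩ := hΔ; obtain ⟨ha1, ha2⟩ := ha; obtain ⟨hb1, hb2⟩ := hb; obtain ⟨hc1, hc2⟩ := hc
  obtain ⟨he1, he2⟩ := hε
  have hA : (16641 : ℝ) / 10000 ≤ tpd ^ 2 := by nlinarith
  have h1 : tpp * (2 * ε + Δ) ≤ 6 := by nlinarith
  have hDt : 0 ≤ Δ * tpp := by
    have : 0 ≤ Δ := by linarith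
    have : 0 ≤ tpp := by linarith
    positivity
  have h2 : Δ * tpp ^ 2 * (2 * ε + Δ) ≤ 6 * (Δ * tpp) := by
    nlinarith [mul_le_mul_of_nonneg_left h1 hDt]
  have h3 : (6656 : ℝ) / 1000 * (Δ * tpp) ≤ 2 * tpd ^ 2 * (2 * Δ * tpp) := by
    have hA4 : (6656 : ℝ) / 1000 ≤ 4 * tpd ^ 2 := by linarith
    nlinarith [mul_le_mul_of_nonneg_right hA4 hDt]
  have h4 : 0 ≤ 2 * tpd ^ 2 * (3 * tpp * ε + Δ * c) := by
    have : 0 ≤ 3 * tpp * ε + Δ * c := by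
      have : 0 ≤ tpp := by linarith
      have : 0 ≤ Δ := by linarith
      have : 0 ≤ c := by linarith
      positivity
    positivity
  have h5 : 0 ≤ c ^ 2 * (6 * ε ^ 2 + 8 * Δ * ε + 3 * Δ ^ 2) := by
    have : 0 ≤ 6 * ε ^ 2 + 8 * Δ * ε + 3 * Δ ^ 2 := by
      have : 0 ≤ Δ := by linarith
      positivity
    positivity
  have h6 : 0 < 2 * (tpd ^ 2) ^ 2 := by
    have : 0 < tpd := by linarith
    positivity
  nlinarith

/-- **`jetSignPoly > 0` ON BOX #18 for every `ε ∈ [0, 5/2]` and every `x ≥ 0`** (decoupled: no Fermi-energy / node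
coupling is used). [folklore] -/
theorem jetSignPoly_pos_la214Box {Δ tpd tpp c ε x : ℝ} (hΔ : Δ ∈ Icc ((17 : ℝ) / 10) (4 : ℝ))
    (ha : tpd ∈ Icc ((129 : ℝ) / 100) ((38 : ℝ) / 25)) (hb : tpp ∈ Icc ((23 : ℝ) / 50) ((33 : ℝ) / 50))
    (hc : c ∈ Icc ((3 : ℝ) / 25) ((3 : ℝ) / 20)) (hε : ε ∈ Icc (0 : ℝ) ((5 : ℝ) / 2)) (hx : 0 ≤ x) :
    0 < jetSignPoly Δ tpd tpp c x ε := by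
  rw [jetSignPoly_eq_grouped]
  have h2 := jetSign_bracket2_pos hΔ ha hb hc hε
  have h1 := jetSign_bracket1_pos hΔ ha hb hc hε
  obtain ⟨hD1, hD2⟩ := hΔ; obtain ⟨ha1, ha2⟩ := ha; obtain ⟨hc1, hc2⟩ := hc; obtain ⟨he1, he2⟩ := hε
  have hc0 : 0 < c := by linarith
  have hD0 : 0 < Δ := by linarith
  have hC0 : 0 < 4 * c * (3 * ε ^ 3 + 6 * Δ * ε ^ 2 + 4 * Δ ^ 2 * ε + Δ ^ 3) + 4 * Δ * tpd ^ 2 * (ε + Δ) := by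
    have : 0 ≤ 3 * ε ^ 3 + 6 * Δ * ε ^ 2 + 4 * Δ ^ 2 * ε := by positivity
    have : 0 < Δ ^ 3 := by positivity
    have : 0 < 4 * Δ * tpd ^ 2 * (ε + Δ) := by
      have : 0 < tpd := by linarith
      have : 0 < ε + Δ := by linarith
      positivity
    nlinarith
  have hg3 : 0 ≤ 256 * x ^ 3 * (tpp ^ 2 - c ^ 2) ^ 2 := by positivity
  have hg2 : 0 ≤ 64 * x ^ 2 *
      (tpd ^ 2 * (3 * tpp ^ 2 + 4 * tpp * c + c ^ 2) - c * (tpp ^ 2 - c ^ 2) * (4 * ε + 3 * Δ)) := by positivity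
  have hg1 : 0 ≤ 16 * x * (2 * (tpd ^ 2) ^ 2 + 2 * tpd ^ 2 * (3 * tpp * ε + Δ * c + 2 * Δ * tpp)
      + c ^ 2 * (6 * ε ^ 2 + 8 * Δ * ε + 3 * Δ ^ 2) - Δ * tpp ^ 2 * (2 * ε + Δ)) := by positivity
  linarith

/-! ## §3 The sign of the jet `t″` on box #18 -/

/-- The contour weights are positive on box #18 for `ε ∈ [0, 5/2]`: `fsD > 0`, `fsN > 0`. [folklore] -/
theorem fsD_fsN_pos_la214Box {Δ tpd tpp c ε : ℝ} (hΔ : Δ ∈ Icc ((17 : ℝ) / 10) (4 : ℝ))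
    (ha : tpd ∈ Icc ((129 : ℝ) / 100) ((38 : ℝ) / 25)) (hb : tpp ∈ Icc ((23 : ℝ) / 50) ((33 : ℝ) / 50))
    (hc : c ∈ Icc ((3 : ℝ) / 25) ((3 : ℝ) / 20)) (hε : ε ∈ Icc (0 : ℝ) ((5 : ℝ) / 2)) :
    0 < fsD Δ tpd c ε ∧ 0 < fsN tpd tpp c ε := by
  obtain ⟨hD1, _⟩ := hΔ; obtain ⟨ha1, _⟩ := ha; obtain ⟨hb1, _⟩ := hb; obtain ⟨hc1, hc2⟩ := hc
  obtain ⟨he1, he2⟩ := hε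
  refine ⟨fsD_pos (by linarith) (by nlinarith), fsN_pos (by intro h; rw [h] at ha1; norm_num at ha1)
    (by linarith) (by linarith) (by linarith) he1⟩

/-- **THE JET `t″` IS POSITIVE on box #18** at every diagonal point `x₀ ≥ 0` and energy `ε ∈ [0, 5/2]` at which the
velocity denominator is positive (`∂_εF(x₀, x₀, ε) > 0` — every band point). [folklore] -/
theorem jetTpp_pos_la214Box {Δ tpd tpp c x₀ ε : ℝ} (hΔ : Δ ∈ Icc ((17 : ℝ) / 10) (4 : ℝ))
    (ha : tpd ∈ Icc ((129 : ℝ) / 100) ((38 : ℝ) / 25)) (hb : tpp ∈ Icc ((23 : ℝ) / 50) ((33 : ℝ) / 50))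
    (hc : c ∈ Icc ((3 : ℝ) / 25) ((3 : ℝ) / 20)) (hε : ε ∈ Icc (0 : ℝ) ((5 : ℝ) / 2)) (hx : 0 ≤ x₀)
    (hF : 0 < dcharCubic Δ tpd tpp c x₀ x₀ ε) : 0 < jetTpp Δ tpd tpp c x₀ ε := by
  obtain ⟨hD, hN⟩ := fsD_fsN_pos_la214Box hΔ ha hb hc hε
  have hG : 0 < gradX Δ tpd tpp c x₀ ε := by
    unfold gradX
    have : 0 ≤ 16 * fsN tpd tpp c ε * x₀ := by positivity
    linarith
  have hP : 0 < jetP Δ tpd tpp c x₀ x₀ ε := by unfold jetP; exact div_pos hG hF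
  rw [jetTpp_pos_iff hF hP]
  -- dgradX < jetP·taylor2  ⇔  dgradX·∂_εF < gradX·taylor2
  have hS := jetSignPoly_pos_la214Box hΔ ha hb hc hε hx
  unfold jetSignPoly at hS
  unfold jetP
  rw [div_mul_eq_mul_div, lt_div_iff₀ hF]
  linarith

/-! ## §4 At the nodal Fermi point of every member -/

/-- The nodal abscissa is non-negative for `ε ≥ 0` (`t_pp ≥ c`, `t_pd ≠ 0`). [folklore] -/
theorem xNode_nonneg {Δ tpd tpp c ε : ℝ} (hΔ : 0 ≤ Δ) (hg : c ≤ tpp) (hε : 0 ≤ ε) :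
    0 ≤ xNode Δ tpd tpp c ε := by
  unfold xNode fsD1 fsN1
  apply div_nonneg
  · exact mul_nonneg hε (by linarith)
  · have : 0 ≤ 2 * ε * (tpp - c) := by nlinarith
    positivity

/-- A positive velocity-matched scale with positive weights forces `∂_εF > 0`. [folklore] -/
theorem dcharCubic_pos_of_scaleT_pos {Δ tpd tpp c x y ε : ℝ} (hS : 0 < scaleT Δ tpd tpp c x y ε)
    (hD : 0 < fsD Δ tpd c ε) (hN : 0 < fsN tpd tpp c ε) : 0 < dcharCubic Δ tpd tpp c x y ε := by
  have hT : 0 < fsT Δ tpd tpp c ε := by unfold fsT; linarith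
  unfold scaleT at hS
  by_contra h
  have : fsT Δ tpd tpp c ε / dcharCubic Δ tpd tpp c x y ε ≤ 0 :=
    div_nonpos_of_nonneg_of_nonpos hT.le (not_lt.mp h)
  linarith

/-- **x = 0 (ν = 1/2): the whole-band `t″` of the nodal jet is POSITIVE for EVERY member of `emeryBoxLa214v123`.**
[folklore] -/
theorem la214Box_jetTpp_pos_x0 {Δ a b c : ℝ} (hΔ : Δ ∈ Icc ((17 : ℝ) / 10) (4 : ℝ))
    (ha : a ∈ Icc ((129 : ℝ) / 100) ((38 : ℝ) / 25)) (hb : b ∈ Icc ((23 : ℝ) / 50) ((33 : ℝ) / 50))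
    (hc : c ∈ Icc ((3 : ℝ) / 25) ((3 : ℝ) / 20)) :
    0 < jetTpp Δ a b c (xNode Δ a b c (fermiEnergyOf Δ a b c ((1 : ℝ) / 2))) (fermiEnergyOf Δ a b c ((1 : ℝ) / 2)) := by
  have hΔ0 : 0 < Δ := lt_of_lt_of_le (by norm_num) hΔ.1
  have ha0 : 0 < a := lt_of_lt_of_le (by norm_num) ha.1
  have hc0 : 0 ≤ c := le_trans (by norm_num) hc.1
  have hb0 : 0 ≤ b := le_trans (by norm_num) hb.1
  have hcb : c ≤ b := by linarith [hc.2, hb.1]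
  have hex := exists_fermiEnergy_of_mem_Ioo (a := a) hΔ0 ha0.ne' hc0 hb0 (ν := (1 : ℝ) / 2) (by norm_num) (by norm_num)
  have hE0 : 0 ≤ fermiEnergyOf Δ a b c ((1 : ℝ) / 2) :=
    fermiEnergyOf_nonneg hΔ0.le hc0 hb0 (by norm_num) (by norm_num) (hex.imp fun _ h => h.2)
  have hE1 : fermiEnergyOf Δ a b c ((1 : ℝ) / 2) ≤ (5 : ℝ) / 2 :=
    (la214Box_fermiEnergyOf_le_ceiling hΔ ha hb hc (by norm_num) le_rfl).trans (by norm_num)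
  have hε : fermiEnergyOf Δ a b c ((1 : ℝ) / 2) ∈ Icc (0 : ℝ) ((5 : ℝ) / 2) := ⟨hE0, hE1⟩
  obtain ⟨hS, -, -, -⟩ := la214Box_oneBandImage_x0 hΔ ha hb hc
  obtain ⟨hD, hN⟩ := fsD_fsN_pos_la214Box hΔ ha hb hc hε
  exact jetTpp_pos_la214Box hΔ ha hb hc hε (xNode_nonneg hΔ0.le hcb hE0)
    (dcharCubic_pos_of_scaleT_pos (lt_of_lt_of_le (by norm_num) hS.1) hD hN)

/-- **x = 1/8 (ν = 7/16): the whole-band `t″` of the nodal jet is POSITIVE for EVERY member of `emeryBoxLa214v123`.**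
[folklore] -/
theorem la214Box_jetTpp_pos_x0125 {Δ a b c : ℝ} (hΔ : Δ ∈ Icc ((17 : ℝ) / 10) (4 : ℝ))
    (ha : a ∈ Icc ((129 : ℝ) / 100) ((38 : ℝ) / 25)) (hb : b ∈ Icc ((23 : ℝ) / 50) ((33 : ℝ) / 50))
    (hc : c ∈ Icc ((3 : ℝ) / 25) ((3 : ℝ) / 20)) :
    0 < jetTpp Δ a b c (xNode Δ a b c (fermiEnergyOf Δ a b c ((7 : ℝ) / 16))) (fermiEnergyOf Δ a b c ((7 : ℝ) / 16)) := by
  have hΔ0 : 0 < Δ := lt_of_lt_of_le (by norm_num) hΔ.1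
  have ha0 : 0 < a := lt_of_lt_of_le (by norm_num) ha.1
  have hc0 : 0 ≤ c := le_trans (by norm_num) hc.1
  have hb0 : 0 ≤ b := le_trans (by norm_num) hb.1
  have hcb : c ≤ b := by linarith [hc.2, hb.1]
  have hex := exists_fermiEnergy_of_mem_Ioo (a := a) hΔ0 ha0.ne' hc0 hb0 (ν := (7 : ℝ) / 16) (by norm_num) (by norm_num)
  have hE0 : 0 ≤ fermiEnergyOf Δ a b c ((7 : ℝ) / 16) :=
    fermiEnergyOf_nonneg hΔ0.le hc0 hb0 (by norm_num) (by norm_num) (hex.imp fun _ h => h.2)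
  have hE1 : fermiEnergyOf Δ a b c ((7 : ℝ) / 16) ≤ (5 : ℝ) / 2 :=
    (la214Box_fermiEnergyOf_le_ceiling hΔ ha hb hc (by norm_num) (by norm_num)).trans (by norm_num)
  have hε : fermiEnergyOf Δ a b c ((7 : ℝ) / 16) ∈ Icc (0 : ℝ) ((5 : ℝ) / 2) := ⟨hE0, hE1⟩
  obtain ⟨hS, -, -, -⟩ := la214Box_oneBandImage_x0125 hΔ ha hb hc
  obtain ⟨hD, hN⟩ := fsD_fsN_pos_la214Box hΔ ha hb hc hε
  exact jetTpp_pos_la214Box hΔ ha hb hc hε (xNode_nonneg hΔ0.le hcb hE0)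
    (dcharCubic_pos_of_scaleT_pos (lt_of_lt_of_le (by norm_num) hS.1) hD hN)

end Summit.Ventures.CertifiedManyBodySolver.Downfold.Emery
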